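import Literature.Probability.RandomPlanarGeometry.ChordalPathFill
import Literature.Probability.RandomPlanarGeometry.StarBubbleMassSign
import HarnessLib

/-!
# The filling of a rooted loop in `ℍ` is a bubble of `Ω_b`; the Brownian bubble measure from a loop process

Proof file (no named fact; one auxiliary notion, `IsRootedLoop`, with a real definition), after

* G. F. Lawler, O. Schramm, W. Werner, *Conformal restriction: the chordal case*, J. Amer.
  Math. Soc. **16** (2003) 917–955, arXiv:math/0209343 (**[LSW]**, arXiv page numbers), §7.1
  "Brownian bubbles" (pp. 27–28): the measure `μ` on Brownian bubbles at `0` "is a measure on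
  the set of bounded `K ⊂ ℍ` with `cl K = K ∪ {0}`. By (5.1) we have for `A ∈ 𝒬*`
  (7.2) `μ[K ∩ A ≠ ∅] = −S g_A(0)/6`. We may think of `μ` as a measure on the space `Ω_b` of
  connected bounded sets `K ⊂ ℍ` such that `cl K = K ∪ {0}` and `ℍ ∖ K` is connected", the
  bubbles being FILLINGS of Brownian loops rooted at `0` (second bullet of §7.1:
  "`μ = c Υ(T^{-1/2} n ⊗ P)`" with "`Υ` the map `(b, e) ↦ fill(Z)`", `Z(t) = T^{1/2} b(t/T) + i e_t`
  a Brownian bridge with an independent Itô excursion as imaginary part); §2 p. 8 ("Fillings").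

STATE OF THE TREE (2026-08-15). The Brownian bubble measure is DEFINED by (7.2)
(`IsBrownianBubbleMeasure`, file `BrownianBubbles`); its existence `exists_isBrownianBubbleMeasure`
is the last input of [LSW] p. 5 result 1 (`exists_isRestrictionMeasure_iff_of_bubble_measure`,
file `RestrictionMeasuresOneBubbleLeaf`). The loop itself is being realised in `ℝ⁴`
(`Process/BrownianLoopDensity4`: the Brownian loop measure at `0` lifted by `W ↦ W⁰ + i|w|`,
`BubbleHittingHarmonic`: the harmonic function with value `−SΦ_A(0)/6 = starBubbleMass A` at
`0`). This file proves the DETERMINISTIC half of the sentence of §7.1 quoted above and isolates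
the probabilistic half as a hypothesis about a random loop, exactly as `ChordalPathFill` does
for the Brownian excursion and `P_1` ([LSW] §4):

* `Literature.Probability.RandomPlanarGeometry.isBrownianBubbleMeasure_iff_measure_hit` — **(7.2)
  with the canonical Schwarzian suffices**: `μ` is a Brownian bubble measure iff
  `μ{K ∩ A ≠ ∅} = starBubbleMass A` for every `A ∈ 𝒬*`; indeed the bubble mass
  `c₂²/d² − c₃/d` of ANY jet of ANY restriction map of `A` equals `starBubbleMass A`
  (`HasRestrictionJet.bubbleMass_eq_starBubbleMass`), both being the half-plane capacity of the
  inverted hull by [LSW] (5.1) (`HasRestrictionJet.hcap_invertedMap`), which does not depend on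
  the hydrodynamic map used to compute it (`IsHydrodynamicMap.hcap_eq`, additivity of `hcap`);
* `Literature.Probability.RandomPlanarGeometry.chordalFill_mem_bubbleConfigs` — **for `S ⊆ ℍ`
  bounded and connected with `cl S = S ∪ {0}`, the filling `chordalFill S` (`ℍ` minus the
  component of `ℂ ∖ cl S` containing the lower half-plane, file `ChordalPathFill`) is a bubble
  of `Ω_b`**: connectedness, `cl = K ∪ {0}` and the hitting equivalence
  `disjoint_chordalFill_iff` are the tree's; NEW are boundedness (a large circle about `0` misses
  `cl S`, is connected and dips below `ℝ`, `mem_outerComponent_of_lt_norm`) and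
  **`ℍ ∖ chordalFill S` is connected** (`isConnected_diff_chordalFill`): it is the unbounded
  component of `ℍ ∖ cl S` (`inter_outerComponent_eq_unboundedComponent`), because a bounded
  component of `ℍ ∖ cl S` cannot touch `ℝ ∖ {0}` — over a real segment off `0` reaching beyond
  `cl S` there is a thin open rectangle in `ℍ ∖ cl S`, which lies in the unbounded component
  (`exists_ball_inter_subset_unboundedComponent`) — so that the outer component minus a bounded
  component of `ℍ ∖ cl S` would be open, contradicting its connectedness;
* `Literature.Probability.RandomPlanarGeometry.IsRootedLoop γ T` — **a loop in `ℍ` rooted at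
  `0`**: `γ` continuous, `T > 0`, `γ 0 = γ T = 0`, `γ(t) ∈ ℍ` for `0 < t < T` (the almost sure
  shape of the Brownian loop of §7.1), with its bubble `IsRootedLoop.bubble = chordalFill γ(0, T) ∈ Ω_b`
  and `disjoint_bubble_iff' : bubble ∩ A = ∅ ↔ ∀ t ≤ T, γ t ∉ A` for `A ∈ 𝒬*`;
* `exists_measurable_bubble_version`, `isBrownianBubbleMeasure_map_bubble`,
  **`exists_isBrownianBubbleMeasure_of_loopProcess`** — on ANY measure space carrying a random
  duration `T` and a random path `B` which almost everywhere form a rooted loop, with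
  a.e.-measurable `T` and marginals, the bubble has an `Ω_b`-valued version measurable for the
  avoidance σ-field, and **if `ν{∃ t ≤ T, B_t ∈ A} = starBubbleMass A = −SΦ_A(0)/6` for every
  `A ∈ 𝒬*`, its image measure is a Brownian bubble measure; hence `exists_isBrownianBubbleMeasure`**.
  What a construction of the loop measure must still supply is thus exactly: the sample-path
  shape and the hitting masses (7.2) of `*`-hulls by the PATH.

## References

* [LSW] §7.1 (pp. 27–28), eq. (7.2); §5 eq. (5.1); §2 p. 8 (Fillings). [LawlerSchrammWerner2003Restriction]
* G. F. Lawler, *Conformally Invariant Processes in the Plane*, AMS (2005), §3.4 (3.8)/(3.10)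
  (additivity of `hcap`), §5.5 Prop. 5.22. [Lawler2005]
-/

noncomputable section

open Set Filter Topology Metric Complex Bornology MeasureTheory
open UpperHalfPlane (upperHalfPlaneSet isOpen_upperHalfPlaneSet)
open scoped NNReal ENNReal

namespace Literature.Probability.RandomPlanarGeometry

open Loewner

/-! ### (7.2) with the canonical Schwarzian characterises Brownian bubble measures -/

section Criterion

variable {A : Set ℂ} {Φ : ConformalEquiv (upperHalfPlaneSet \ A) upperHalfPlaneSet} {d c₂ c₃ : ℝ}

/-- **The half-plane capacity of a hull does not depend on its hydrodynamic map**: for two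
hydrodynamically normalised conformal maps `ψ₁, ψ₂ : ℍ ∖ K → ℍ`, additivity of `hcap` under
`ψ₂ = (ψ₂ ∘ ψ₁⁻¹) ∘ ψ₁` and nonnegativity of the capacity of the (empty) quotient hull give
`hcap ψ₂ ≥ hcap ψ₁`, and symmetrically. [cite: Lawler2005, §3.4 (3.8)/(3.10)] -/
theorem IsHydrodynamicMap.hcap_eq {K : Set ℂ}
    {ψ₁ ψ₂ : ConformalEquiv (upperHalfPlaneSet \ K) upperHalfPlaneSet}
    (h₁ : IsHydrodynamicMap K ψ₁) (h₂ : IsHydrodynamicMap K ψ₂)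
    (hb : IsBounded (K ∩ upperHalfPlaneSet)) : hcap K ψ₁ = hcap K ψ₂ := by
  have h12 : upperHalfPlaneSet \ K ⊆ upperHalfPlaneSet \ K := Subset.rfl
  have hq₁ := h₁.hcap_diffQuotient h₂ hb hb h12
  have hq₂ := h₂.hcap_diffQuotient h₁ hb hb h12
  have h0₁ : 0 ≤ hcap (diffImage ψ₁ K) (RandomPlanarGeometry.diffQuotient ψ₁ ψ₂ h12) :=
    (h₁.diffQuotient h₂ hb h12).hcap_nonneg (h₁.isBounded_diffImage hb hb)
  have h0₂ : 0 ≤ hcap (diffImage ψ₂ K) (RandomPlanarGeometry.diffQuotient ψ₂ ψ₁ h12) :=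
    (h₂.diffQuotient h₁ hb h12).hcap_nonneg (h₂.isBounded_diffImage hb hb)
  linarith

/-- **The bubble mass of any jet of any restriction map of `A ∈ 𝒬*` is the canonical one**:
`c₂²/d² − c₃/d = starBubbleMass A`, both being `hcap` of the inverted hull `{−1/z : z ∈ A}` by
[LSW] (5.1) (`d = Φ'_A(0) > 0` by uniqueness of the restriction derivative).
[cite: LawlerSchrammWerner2003Restriction, §5 eq. (5.1)] -/
theorem HasRestrictionJet.bubbleMass_eq_starBubbleMass (hA : IsStarHull A) (hΦ : IsRestrictionMap A Φ)
    (hJ : HasRestrictionJet A Φ d c₂ c₃) : bubbleMass d c₂ c₃ = starBubbleMass A := by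
  have hd : 0 < d := by
    rw [hJ.hasRestrictionDeriv.eq_starDeriv hA hΦ]
    exact (starDeriv_spec hA).1
  obtain ⟨δ, hδ, hAδ⟩ := hA.exists_pos_disjoint_ball
  rw [← hJ.hcap_invertedMap hd hδ hAδ, starBubbleMass_eq_hcap hA hδ hAδ]
  exact IsHydrodynamicMap.hcap_eq (hJ.isHydrodynamicMap_invertedMap hd)
    ((hasRestrictionJet_starRMap hA).isHydrodynamicMap_invertedMap (starDeriv_spec hA).1)
    (isBounded_invHull_inter hδ hAδ)

/-- **Criterion for a Brownian bubble measure**: `μ` on `Ω_b` satisfies (7.2) for every jet of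
every restriction map of every `A ∈ 𝒬*` iff `μ{K ∩ A ≠ ∅} = starBubbleMass A = −SΦ_A(0)/6`
for every `A ∈ 𝒬*`. [cite: LawlerSchrammWerner2003Restriction, §7.1 eq. (7.2) (p. 28)] -/
theorem isBrownianBubbleMeasure_iff_measure_hit {μ : Measure BubbleConfig} :
    IsBrownianBubbleMeasure μ ↔
      ∀ ⦃A : Set ℂ⦄, IsStarHull A → μ (BubbleConfig.hit A) = ENNReal.ofReal (starBubbleMass A) := by
  constructor
  · intro h A hA
    exact h.measure_hit_eq_starBubbleMass hA
  · intro h A hA Φ hΦ d c₂ c₃ hJ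
    rw [h hA, hJ.bubbleMass_eq_starBubbleMass hA hΦ]

end Criterion

/-! ### The outer component of a bounded set and the unbounded component of `ℍ ∖ cl S` -/

section OuterGeometry

variable {S : Set ℂ} {R : ℝ}

/-- **Far points lie in the outer component**: for `S ⊆ ℍ̄` with `cl S ⊆ closedBall 0 R`,
`R ≥ 0`, every `z` with `|z| > R` is in the component of `ℂ ∖ cl S` containing the lower
half-plane — the circle `|w| = |z|` misses `cl S`, is connected, and passes through `−|z| i`.
[folklore] -/
theorem mem_outerComponent_of_lt_norm (hS : S ⊆ {z : ℂ | 0 ≤ z.im}) (hR0 : 0 ≤ R)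
    (hR : closure S ⊆ closedBall (0 : ℂ) R) {z : ℂ} (hz : R < ‖z‖) : z ∈ outerComponent S := by
  have hz0 : 0 < ‖z‖ := hR0.trans_lt hz
  have hsub : sphere (0 : ℂ) ‖z‖ ⊆ (closure S)ᶜ := fun w hw hwS ↦ by
    have h1 : ‖w‖ ≤ R := by simpa using hR hwS
    have h2 : ‖w‖ = ‖z‖ := by simpa using hw
    linarith
  have hpre : IsPreconnected (sphere (0 : ℂ) ‖z‖) :=
    isPreconnected_sphere (by simp [Complex.rank_real_complex]) 0 ‖z‖
  set w₀ : ℂ := -((‖z‖ : ℝ) : ℂ) * I with hw₀def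
  have hw₀ : w₀ ∈ sphere (0 : ℂ) ‖z‖ := by
    rw [mem_sphere, dist_zero_right, hw₀def, norm_mul, norm_neg, Complex.norm_real, Complex.norm_I,
      mul_one, Real.norm_eq_abs, abs_of_pos hz0]
  have hw₀o : w₀ ∈ outerComponent S := by
    refine mem_outerComponent_of_im_neg hS ?_
    rw [hw₀def]
    simp only [neg_mul, neg_im, mul_im, ofReal_re, I_im, mul_one, ofReal_im, I_re, mul_zero, add_zero,
      Left.neg_neg_iff]
    exact hz0
  have h := hpre.subset_connectedComponentIn hw₀ hsub
  have hzs : z ∈ sphere (0 : ℂ) ‖z‖ := by simp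
  show z ∈ connectedComponentIn (closure S)ᶜ (-I)
  rw [connectedComponentIn_eq hw₀o]
  exact h hzs

/-- **The filling of a bounded set is bounded** (`S ⊆ ℍ̄`, `cl S ⊆ closedBall 0 R`). [folklore] -/
theorem chordalFill_subset_closedBall (hS : S ⊆ {z : ℂ | 0 ≤ z.im}) (hR0 : 0 ≤ R)
    (hR : closure S ⊆ closedBall (0 : ℂ) R) : chordalFill S ⊆ closedBall 0 R := fun z hz ↦ by
  by_contra h
  rw [mem_closedBall, dist_zero_right, not_le] at h
  exact hz.2 (mem_outerComponent_of_lt_norm hS hR0 hR h)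

/-- **Half-discs at nonzero real points lie in the unbounded component of `ℍ ∖ F`**, for `F`
closed, `F ⊆ closedBall 0 R`, meeting `ℝ` at most at `0`: over a real segment `[a, b] ∌ 0`
through `p` reaching modulus `|R| + 2` there is, by compactness, a thin open rectangle
`[a, b] × (0, δ)` off `F`; it is convex, contains a far point of `ℍ`, hence lies in the
unbounded component, and contains the upper half of `B(p, min(|p|/2, δ))`. [folklore] -/
theorem exists_ball_inter_subset_unboundedComponent {F : Set ℂ} (hF : IsClosed F)
    (hFR : F ⊆ closedBall (0 : ℂ) R) (hreal : ∀ x : ℝ, (x : ℂ) ∈ F → x = 0) {p : ℝ} (hp : p ≠ 0) :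
    ∃ r > 0, ball (p : ℂ) r ∩ upperHalfPlaneSet ⊆
      Loewner.unboundedComponent (upperHalfPlaneSet \ F) := by
  -- a real segment `[a, b] ∌ 0` containing `(p - |p|/2, p + |p|/2)` and a far abscissa
  obtain ⟨a, b, h0, hpa, hpb, hfar⟩ : ∃ a b : ℝ, (0 < a ∨ b < 0) ∧ a ≤ p - |p| / 2 ∧
      p + |p| / 2 ≤ b ∧ (|R| + 2 ≤ b ∨ a ≤ -(|R| + 2)) := by
    rcases lt_or_gt_of_ne hp with hp' | hp'
    · refine ⟨min (2 * p) (-(|R| + 2)), p / 2, Or.inr (by linarith), ?_, ?_, Or.inr (min_le_right _ _)⟩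
      · rw [abs_of_neg hp']
        have := min_le_left (2 * p) (-(|R| + 2))
        linarith
      · rw [abs_of_neg hp']
        linarith
    · refine ⟨p / 2, max (2 * p) (|R| + 2), Or.inl (by linarith), ?_, ?_, Or.inl (le_max_right _ _)⟩
      · rw [abs_of_pos hp']
        linarith
      · rw [abs_of_pos hp']
        exact le_trans (by linarith) (le_max_left _ _)
  -- the segment, a compact set missing `F`
  set L : Set ℂ := ((↑) : ℝ → ℂ) '' Icc a b with hL
  have hLc : IsCompact L := isCompact_Icc.image continuous_ofReal
  have hLF : Disjoint L F := by
    rw [Set.disjoint_left]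
    rintro _ ⟨x, hx, rfl⟩ hxF
    have hx0 := hreal x hxF
    rw [hx0] at hx
    rcases h0 with h0 | h0
    · linarith [hx.1]
    · linarith [hx.2]
  obtain ⟨δ, hδ, hdisj⟩ := hLF.exists_thickenings hLc hF
  -- the rectangle `[a, b] × (0, δ)`
  set Q : Set ℂ := ({z : ℂ | a ≤ z.re} ∩ {z : ℂ | z.re ≤ b}) ∩ ({z : ℂ | 0 < z.im} ∩ {z : ℂ | z.im < δ})
    with hQ
  have hQsub : Q ⊆ upperHalfPlaneSet \ F := by
    rintro z ⟨⟨hza, hzb⟩, hz0, hzδ⟩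
    refine ⟨hz0, fun hzF ↦ ?_⟩
    have hzL : z ∈ thickening δ L := by
      rw [mem_thickening_iff]
      refine ⟨(z.re : ℂ), ⟨z.re, ⟨hza, hzb⟩, rfl⟩, ?_⟩
      have hsub : z - (z.re : ℂ) = (z.im : ℂ) * I := Complex.ext (by simp) (by simp)
      rw [dist_eq_norm, hsub, norm_mul, Complex.norm_I, mul_one, Complex.norm_real, Real.norm_eq_abs,
        abs_of_pos hz0]
      exact hzδ
    exact Set.disjoint_left.1 hdisj hzL (self_subset_thickening hδ F hzF)
  have hQconv : Convex ℝ Q :=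
    ((convex_halfSpace_re_ge a).inter (convex_halfSpace_re_le b)).inter
      ((convex_halfSpace_im_gt 0).inter (convex_halfSpace_im_lt δ))
  -- a far point of `Q`
  have hab : a ≤ b := by
    have := abs_nonneg p
    linarith
  obtain ⟨w, hwQ, hwR⟩ : ∃ w ∈ Q, R < ‖w‖ := by
    rcases hfar with hb | ha
    · refine ⟨(b : ℂ) + ((δ / 2 : ℝ) : ℂ) * I, ⟨⟨by simpa using hab, by simp⟩, ?_, ?_⟩, ?_⟩
      · show 0 < ((b : ℂ) + ((δ / 2 : ℝ) : ℂ) * I).im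
        simp only [add_im, ofReal_im, mul_im, ofReal_re, I_im, mul_one, I_re, mul_zero, add_zero, zero_add]
        positivity
      · show ((b : ℂ) + ((δ / 2 : ℝ) : ℂ) * I).im < δ
        simp only [add_im, ofReal_im, mul_im, ofReal_re, I_im, mul_one, I_re, mul_zero, add_zero, zero_add]
        linarith
      · calc R ≤ |R| := le_abs_self R
          _ < b := by linarith
          _ ≤ |((b : ℂ) + ((δ / 2 : ℝ) : ℂ) * I).re| := by simp [le_abs_self]
          _ ≤ ‖(b : ℂ) + ((δ / 2 : ℝ) : ℂ) * I‖ := abs_re_le_norm _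
    · refine ⟨(a : ℂ) + ((δ / 2 : ℝ) : ℂ) * I, ⟨⟨by simp, by simpa using hab⟩, ?_, ?_⟩, ?_⟩
      · show 0 < ((a : ℂ) + ((δ / 2 : ℝ) : ℂ) * I).im
        simp only [add_im, ofReal_im, mul_im, ofReal_re, I_im, mul_one, I_re, mul_zero, add_zero, zero_add]
        positivity
      · show ((a : ℂ) + ((δ / 2 : ℝ) : ℂ) * I).im < δ
        simp only [add_im, ofReal_im, mul_im, ofReal_re, I_im, mul_one, I_re, mul_zero, add_zero, zero_add]
        linarith
      · calc R ≤ |R| := le_abs_self R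
          _ < -a := by linarith
          _ ≤ |((a : ℂ) + ((δ / 2 : ℝ) : ℂ) * I).re| := by simp [neg_le_abs]
          _ ≤ ‖(a : ℂ) + ((δ / 2 : ℝ) : ℂ) * I‖ := abs_re_le_norm _
  -- `Q` lies in the unbounded component
  have hQV : Q ⊆ Loewner.unboundedComponent (upperHalfPlaneSet \ F) := by
    rw [unboundedComponent_eq_connectedComponentIn hFR (hQsub hwQ).1 hwR]
    exact hQconv.isPreconnected.subset_connectedComponentIn hwQ hQsub
  -- the half-ball at `p` of radius `min (|p|/2) δ` lies in `Q`
  refine ⟨min (|p| / 2) δ, lt_min (half_pos (abs_pos.2 hp)) hδ, fun z hz ↦ hQV ?_⟩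
  obtain ⟨hzb, hzH⟩ := hz
  rw [mem_ball, dist_eq_norm] at hzb
  have hre : |z.re - p| < |p| / 2 :=
    calc |z.re - p| = |(z - (p : ℂ)).re| := by simp
      _ ≤ ‖z - (p : ℂ)‖ := abs_re_le_norm _
      _ < min (|p| / 2) δ := hzb
      _ ≤ |p| / 2 := min_le_left _ _
  have him : z.im < δ :=
    calc z.im = (z - (p : ℂ)).im := by simp
      _ ≤ |(z - (p : ℂ)).im| := le_abs_self _
      _ ≤ ‖z - (p : ℂ)‖ := abs_im_le_norm _
      _ < min (|p| / 2) δ := hzb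
      _ ≤ δ := min_le_right _ _
  have hzH' : 0 < z.im := hzH
  rw [abs_lt] at hre
  exact ⟨⟨by show a ≤ z.re; linarith [hre.1], by show z.re ≤ b; linarith [hre.2]⟩, hzH', him⟩

/-- **The outer component meets `ℍ` in the unbounded component of `ℍ ∖ cl S`** (`S ⊆ ℍ̄`
bounded, `cl S ∩ ℝ = {0}`). `⊇`: the unbounded component is connected, off `cl S`, and
contains far points, which are in the outer component. `⊆`: if `z ∈ ℍ ∩ outer` had a bounded
component `W` in `ℍ ∖ cl S`, then `outer ∖ W` would be open — near a point of `ℍ` use its own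
component, near a point below `ℝ` the lower half-plane, near a real point (`≠ 0`) a half-disc
inside the unbounded component (`exists_ball_inter_subset_unboundedComponent`) — and `outer`,
connected, would split into the open sets `W ∌ −i` and `outer ∖ W ∌ z`. [folklore] -/
theorem inter_outerComponent_eq_unboundedComponent (hS : S ⊆ {z : ℂ | 0 ≤ z.im}) (hb : IsBounded S)
    (hreal : ∀ x : ℝ, (x : ℂ) ∈ closure S → x = 0) (h0 : (0 : ℂ) ∈ closure S) :
    upperHalfPlaneSet ∩ outerComponent S =
      Loewner.unboundedComponent (upperHalfPlaneSet \ closure S) := by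
  obtain ⟨R, hR0, hFR⟩ : ∃ R, 0 ≤ R ∧ closure S ⊆ closedBall (0 : ℂ) R := by
    obtain ⟨R, hR⟩ := hb.closure.subset_closedBall 0
    exact ⟨max R 0, le_max_right _ _, hR.trans (closedBall_subset_closedBall (le_max_left _ _))⟩
  obtain ⟨hw, hwR⟩ := farPoint_mem R
  have hwV : ((|R| + 1 : ℝ) : ℂ) * I ∈ Loewner.unboundedComponent (upperHalfPlaneSet \ closure S) :=
    mem_unboundedComponent_of_lt_norm hFR hw hwR
  have hwO : ((|R| + 1 : ℝ) : ℂ) * I ∈ outerComponent S := mem_outerComponent_of_lt_norm hS hR0 hFR hwR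
  refine Subset.antisymm ?_ fun z hzV ↦ ⟨hzV.1.1, ?_⟩
  · rintro z ⟨hzH, hzO⟩
    by_contra hzV
    have hzF : z ∉ closure S := outerComponent_subset S hzO
    set W := connectedComponentIn (upperHalfPlaneSet \ closure S) z with hW
    have hWb : IsBounded W := by
      by_contra h
      exact hzV ⟨⟨hzH, hzF⟩, h⟩
    have hWopen : IsOpen W := (isOpen_upperHalfPlaneSet.sdiff isClosed_closure).connectedComponentIn
    have hWH : W ⊆ upperHalfPlaneSet \ closure S := connectedComponentIn_subset _ _
    -- no point of `W` is in the unbounded component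
    have hWV : ∀ q ∈ W, q ∉ Loewner.unboundedComponent (upperHalfPlaneSet \ closure S) := by
      intro q hq hqV
      have h1 : connectedComponentIn (upperHalfPlaneSet \ closure S) q = W := (connectedComponentIn_eq hq).symm
      exact hqV.2 (h1 ▸ hWb)
    -- `outer ∖ W` is open
    have hopen : IsOpen (outerComponent S \ W) := by
      rw [isOpen_iff_mem_nhds]
      rintro q ⟨hqO, hqW⟩
      have hqF : q ∉ closure S := outerComponent_subset S hqO
      rcases lt_trichotomy q.im 0 with him | him | him
      · filter_upwards [(isOpen_outerComponent S).mem_nhds hqO,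
          (isOpen_lt continuous_im continuous_const).mem_nhds him] with y hyO hyim
        exact ⟨hyO, fun hyW ↦ absurd (show (0 : ℝ) < y.im from (hWH hyW).1) (not_lt.2 (le_of_lt hyim))⟩
      · have hq : q = (q.re : ℂ) := Complex.ext (by simp) (by simp [him])
        have hq0 : q.re ≠ 0 := fun h ↦ by
          apply hqF
          rw [hq, h, ofReal_zero]
          exact h0
        obtain ⟨r, hr, hball⟩ :=
          exists_ball_inter_subset_unboundedComponent isClosed_closure hFR hreal hq0
        rw [← hq] at hball
        filter_upwards [(isOpen_outerComponent S).mem_nhds hqO, ball_mem_nhds q hr] with y hyO hyb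
        exact ⟨hyO, fun hyW ↦ hWV y hyW (hball ⟨hyb, (hWH hyW).1⟩)⟩
      · have hqHF : q ∈ upperHalfPlaneSet \ closure S := ⟨him, hqF⟩
        have hWq : IsOpen (connectedComponentIn (upperHalfPlaneSet \ closure S) q) :=
          (isOpen_upperHalfPlaneSet.sdiff isClosed_closure).connectedComponentIn
        filter_upwards [(isOpen_outerComponent S).mem_nhds hqO,
          hWq.mem_nhds (mem_connectedComponentIn hqHF)] with y hyO hyq
        refine ⟨hyO, fun hyW ↦ hqW ?_⟩
        have h1 : connectedComponentIn (upperHalfPlaneSet \ closure S) q =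
            connectedComponentIn (upperHalfPlaneSet \ closure S) y := connectedComponentIn_eq hyq
        have h2 : W = connectedComponentIn (upperHalfPlaneSet \ closure S) y := connectedComponentIn_eq hyW
        show q ∈ W
        rw [h2, ← h1]
        exact mem_connectedComponentIn hqHF
    -- contradiction with the connectedness of the outer component
    have hOconn := (isConnected_outerComponent hS).isPreconnected
    rw [isPreconnected_iff_subset_of_disjoint] at hOconn
    have hcover : outerComponent S ⊆ W ∪ (outerComponent S \ W) := fun y hy ↦ by
      by_cases h : y ∈ W
      · exact Or.inl h
      · exact Or.inr ⟨hy, h⟩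
    have hdisj : outerComponent S ∩ (W ∩ (outerComponent S \ W)) = ∅ := by
      rw [eq_empty_iff_forall_notMem]
      rintro y ⟨-, hyW, -, hyW'⟩
      exact hyW' hyW
    rcases hOconn W (outerComponent S \ W) hWopen hopen hcover hdisj with h | h
    · have := (hWH (h (neg_I_mem_outerComponent hS))).1
      norm_num [upperHalfPlaneSet] at this
    · exact (h hzO).2 (mem_connectedComponentIn ⟨hzH, hzF⟩)
  · have hVpre : IsPreconnected (Loewner.unboundedComponent (upperHalfPlaneSet \ closure S)) :=
      (isConnected_unboundedComponent hb.closure).isPreconnected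
    have hVsub : Loewner.unboundedComponent (upperHalfPlaneSet \ closure S) ⊆ (closure S)ᶜ :=
      fun v hv ↦ hv.1.2
    have h := hVpre.subset_connectedComponentIn hwV hVsub
    show z ∈ connectedComponentIn (closure S)ᶜ (-I)
    rw [connectedComponentIn_eq hwO]
    exact h hzV

/-- Real points of `cl S = S ∪ {0}` vanish, for `S ⊆ ℍ`. [folklore] -/
theorem eq_zero_of_ofReal_mem_closure (hS : S ⊆ upperHalfPlaneSet) (hcl : closure S = S ∪ {0})
    {x : ℝ} (hx : (x : ℂ) ∈ closure S) : x = 0 := by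
  rw [hcl] at hx
  rcases hx with hx | hx
  · have : (0 : ℝ) < (x : ℂ).im := hS hx
    simp at this
  · exact_mod_cast (mem_singleton_iff.1 hx)

/-- **`ℍ ∖ chordalFill S` is connected** for `S ⊆ ℍ` bounded with `cl S = S ∪ {0}`: it is the
unbounded component of `ℍ ∖ cl S`. [folklore] -/
theorem isConnected_diff_chordalFill (hS : S ⊆ upperHalfPlaneSet) (hb : IsBounded S)
    (hcl : closure S = S ∪ {0}) : IsConnected (upperHalfPlaneSet \ chordalFill S) := by
  have hS' : S ⊆ {z : ℂ | 0 ≤ z.im} := fun z hz ↦ (show (0 : ℝ) < z.im from hS hz).le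
  have hreal : ∀ x : ℝ, (x : ℂ) ∈ closure S → x = 0 := fun x hx ↦ eq_zero_of_ofReal_mem_closure hS hcl hx
  have h0 : (0 : ℂ) ∈ closure S := by
    rw [hcl]
    exact Or.inr rfl
  have heq : upperHalfPlaneSet \ chordalFill S = upperHalfPlaneSet ∩ outerComponent S := by
    ext z
    simp only [chordalFill, Set.mem_sdiff, mem_inter_iff, not_and, not_not]
    exact ⟨fun ⟨h1, h2⟩ ↦ ⟨h1, h2 h1⟩, fun ⟨h1, h2⟩ ↦ ⟨h1, fun _ ↦ h2⟩⟩
  rw [heq, inter_outerComponent_eq_unboundedComponent hS' hb hreal h0]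
  exact isConnected_unboundedComponent hb.closure

/-- **The filling of a bounded connected `S ⊆ ℍ` with `cl S = S ∪ {0}` is a bubble of `Ω_b`**
([LSW] §7.1: "the space `Ω_b` of connected bounded sets `K ⊂ ℍ` such that `cl K = K ∪ {0}`
and `ℍ ∖ K` is connected"). [cite: LawlerSchrammWerner2003Restriction, §7.1 (p. 28, Ω_b) with §2 p. 8 (Fillings)] -/
theorem chordalFill_mem_bubbleConfigs (hS : S ⊆ upperHalfPlaneSet) (hconn : IsConnected S)
    (hcl : closure S = S ∪ {0}) (hb : IsBounded S) : chordalFill S ∈ bubbleConfigs := by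
  have hS' : S ⊆ {z : ℂ | 0 ≤ z.im} := fun z hz ↦ (show (0 : ℝ) < z.im from hS hz).le
  have hreal : ∀ x : ℝ, (x : ℂ) ∈ closure S → x = 0 := fun x hx ↦ eq_zero_of_ofReal_mem_closure hS hcl hx
  have h0 : (0 : ℂ) ∈ closure S := by
    rw [hcl]
    exact Or.inr rfl
  obtain ⟨R, hR0, hR⟩ : ∃ R, 0 ≤ R ∧ closure S ⊆ closedBall (0 : ℂ) R := by
    obtain ⟨R, hR⟩ := hb.closure.subset_closedBall 0
    exact ⟨max R 0, le_max_right _ _, hR.trans (closedBall_subset_closedBall (le_max_left _ _))⟩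
  refine ⟨chordalFill_subset S, isBounded_closedBall.subset (chordalFill_subset_closedBall hS' hR0 hR),
    isConnected_chordalFill hS hconn hcl, ?_, isConnected_diff_chordalFill hS hb hcl⟩
  rw [closure_chordalFill hS hreal h0, compl_outerComponent_eq hS hreal h0]

end OuterGeometry

/-! ### Loops in `ℍ` rooted at `0` and their bubbles -/

/-- **A loop in the upper half-plane rooted at `0`**: `γ : [0, ∞) → ℂ` continuous, of duration
`T > 0`, with `γ 0 = γ T = 0` and `γ(t) ∈ ℍ` for `0 < t < T` — the almost sure shape of the
Brownian loop of [LSW] §7.1 (second bullet: `Z(t) = T^{1/2} b(t/T) + i e_t`, `0 ≤ t ≤ T`, with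
`e` a positive excursion and `b` a bridge from `0` to `0`). Values after `T` are irrelevant.
[cite: LawlerSchrammWerner2003Restriction, §7.1 (p. 28, second bullet)] -/
def IsRootedLoop (γ : ℝ≥0 → ℂ) (T : ℝ≥0) : Prop :=
  Continuous γ ∧ 0 < T ∧ γ 0 = 0 ∧ γ T = 0 ∧ ∀ t : ℝ≥0, 0 < t → t < T → 0 < (γ t).im

namespace IsRootedLoop

variable {γ : ℝ≥0 → ℂ} {T : ℝ≥0}

/-- A rooted loop is continuous. [folklore] -/
theorem continuous (h : IsRootedLoop γ T) : Continuous γ := h.1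

/-- A rooted loop has positive duration. [folklore] -/
theorem pos (h : IsRootedLoop γ T) : 0 < T := h.2.1

/-- A rooted loop starts at `0`. [folklore] -/
theorem apply_zero (h : IsRootedLoop γ T) : γ 0 = 0 := h.2.2.1

/-- A rooted loop ends at `0`. [folklore] -/
theorem apply_end (h : IsRootedLoop γ T) : γ T = 0 := h.2.2.2.1

/-- A rooted loop is in `ℍ` at intermediate times. [folklore] -/
theorem im_pos (h : IsRootedLoop γ T) {t : ℝ≥0} (h0 : 0 < t) (hT : t < T) : 0 < (γ t).im :=
  h.2.2.2.2 t h0 hT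

/-- `γ(0, T) ⊆ ℍ`. [folklore] -/
theorem image_Ioo_subset (h : IsRootedLoop γ T) : γ '' Ioo 0 T ⊆ upperHalfPlaneSet := by
  rintro _ ⟨t, ht, rfl⟩
  exact h.im_pos ht.1 ht.2

/-- `γ(0, T)` is connected. [folklore] -/
theorem isConnected_image_Ioo (h : IsRootedLoop γ T) : IsConnected (γ '' Ioo 0 T) :=
  (isConnected_Ioo h.pos).image _ h.continuous.continuousOn

/-- `γ[0, T] = γ(0, T) ∪ {0}`. [folklore] -/
theorem image_Icc_eq (h : IsRootedLoop γ T) : γ '' Icc 0 T = γ '' Ioo 0 T ∪ {0} := by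
  ext z
  constructor
  · rintro ⟨t, ht, rfl⟩
    rcases ht.1.eq_or_lt with h0 | h0
    · right
      rw [← h0, h.apply_zero]
      rfl
    rcases ht.2.eq_or_lt with hT | hT
    · right
      rw [hT, h.apply_end]
      rfl
    · exact Or.inl ⟨t, ⟨h0, hT⟩, rfl⟩
  · rintro (⟨t, ht, rfl⟩ | rfl)
    · exact ⟨t, Ioo_subset_Icc_self ht, rfl⟩
    · exact ⟨0, ⟨le_rfl, h.pos.le⟩, h.apply_zero⟩

/-- `γ[0, T]` is compact. [folklore] -/
theorem isCompact_image_Icc (h : IsRootedLoop γ T) : IsCompact (γ '' Icc 0 T) :=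
  isCompact_Icc.image h.continuous

/-- `cl γ(0, T) = γ(0, T) ∪ {0}`. [folklore] -/
theorem closure_image_Ioo (h : IsRootedLoop γ T) : closure (γ '' Ioo 0 T) = γ '' Ioo 0 T ∪ {0} := by
  rw [← h.image_Icc_eq]
  refine Subset.antisymm
    (closure_minimal (image_mono Ioo_subset_Icc_self) h.isCompact_image_Icc.isClosed) ?_
  rw [← closure_Ioo h.pos.ne]
  exact image_closure_subset_closure_image h.continuous

/-- `γ(0, T)` is bounded. [folklore] -/
theorem isBounded_image_Ioo (h : IsRootedLoop γ T) : IsBounded (γ '' Ioo 0 T) :=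
  h.isCompact_image_Icc.isBounded.subset (image_mono Ioo_subset_Icc_self)

/-- The filling of `γ(0, T)` is a bubble. [cite: LawlerSchrammWerner2003Restriction, §7.1 (p. 28, Ω_b)] -/
theorem chordalFill_mem_bubbleConfigs (h : IsRootedLoop γ T) :
    chordalFill (γ '' Ioo 0 T) ∈ bubbleConfigs :=
  RandomPlanarGeometry.chordalFill_mem_bubbleConfigs h.image_Ioo_subset h.isConnected_image_Ioo
    h.closure_image_Ioo h.isBounded_image_Ioo

/-- **The bubble `fill(γ(0, T)) ∈ Ω_b` of a rooted loop** ([LSW] §7.1: the Brownian bubble is the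
filling of the loop). [cite: LawlerSchrammWerner2003Restriction, §7.1 (p. 28)] -/
def bubble (h : IsRootedLoop γ T) : BubbleConfig :=
  ⟨chordalFill (γ '' Ioo 0 T), h.chordalFill_mem_bubbleConfigs⟩

/-- The underlying set of the bubble. [folklore] -/
@[simp] theorem coe_bubble (h : IsRootedLoop γ T) :
    ((h.bubble : BubbleConfig) : Set ℂ) = chordalFill (γ '' Ioo 0 T) := rfl

/-- The loop lies in its bubble. [folklore] -/
theorem image_Ioo_subset_bubble (h : IsRootedLoop γ T) :
    γ '' Ioo 0 T ⊆ ((h.bubble : BubbleConfig) : Set ℂ) :=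
  subset_chordalFill h.image_Ioo_subset

/-- **The bubble avoids `A ∈ 𝒬*` iff the loop does** (`γ[0, T] = γ(0, T) ∪ {0}` and `0 ∉ A`;
the tree's `disjoint_chordalFill_iff`). [folklore] -/
theorem disjoint_bubble_iff (h : IsRootedLoop γ T) {A : Set ℂ} (hA : IsStarHull A) :
    Disjoint ((h.bubble : BubbleConfig) : Set ℂ) A ↔ Disjoint (γ '' Icc 0 T) A := by
  rw [coe_bubble, disjoint_chordalFill_iff h.image_Ioo_subset h.closure_image_Ioo hA, h.image_Icc_eq,
    Set.disjoint_union_left, Set.disjoint_singleton_left]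
  exact ⟨fun h' ↦ ⟨h', hA.zero_notMem⟩, fun h' ↦ h'.1⟩

/-- The bubble avoids `A ∈ 𝒬*` iff `γ t ∉ A` for all `t ≤ T`. [folklore] -/
theorem disjoint_bubble_iff' (h : IsRootedLoop γ T) {A : Set ℂ} (hA : IsStarHull A) :
    Disjoint ((h.bubble : BubbleConfig) : Set ℂ) A ↔ ∀ t ≤ T, γ t ∉ A := by
  rw [h.disjoint_bubble_iff hA, Set.disjoint_left]
  constructor
  · intro hd t ht hγ
    exact hd ⟨t, ⟨zero_le, ht⟩, rfl⟩ hγ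
  · rintro hd _ ⟨t, ht, rfl⟩ hγ
    exact hd t ht.2 hγ

end IsRootedLoop

/-! ### Random rooted loops: a measurable `Ω_b`-valued version of the bubble, and its law -/

/-- A map into `Ω_b` is measurable for the avoidance σ-field as soon as the avoidance events of
`*`-hulls pull back to measurable sets. [cite: LawlerSchrammWerner2003Restriction, §7.1 (p. 28) with §3 (p. 10)] -/
theorem BubbleConfig.measurable_of_measurableSet_preimage_avoid {α : Type*} [MeasurableSpace α]
    {f : α → BubbleConfig} (h : ∀ A : Set ℂ, IsStarHull A → MeasurableSet (f ⁻¹' BubbleConfig.avoid A)) :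
    Measurable f :=
  measurable_generateFrom fun _ ⟨A, hA, hS⟩ ↦ hS ▸ h A hA

/-- **The event "the path visits the closed set `A` by time `T`" described countably**: for a
continuous path and `A` closed nonempty, `∃ t ≤ T, γ t ∈ A` iff for every `n` some rational
time `q ∈ [0, T]` has `infDist (γ q) A < 1/(n+1)` (`⇒`: continuity at the visiting time, a
rational slightly to its left, or `q = 0`; `⇐`: compactness of `[0, T]` and closedness of `A`).
[folklore] -/
theorem exists_le_mem_iff_forall_rat {γ : ℝ≥0 → ℂ} (hγ : Continuous γ) {A : Set ℂ} (hA : IsClosed A)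
    (hne : A.Nonempty) (T : ℝ≥0) :
    (∃ t ≤ T, γ t ∈ A) ↔ ∀ n : ℕ, ∃ q : ℚ, (0 : ℝ) ≤ q ∧ (q : ℝ).toNNReal ≤ T ∧
      infDist (γ (q : ℝ).toNNReal) A < 1 / ((n : ℝ) + 1) := by
  have hcont : Continuous fun t ↦ infDist (γ t) A := (continuous_infDist_pt A).comp hγ
  constructor
  · rintro ⟨t, htT, ht⟩ n
    have ht0 : infDist (γ t) A = 0 := infDist_zero_of_mem ht
    have hε : (0 : ℝ) < 1 / ((n : ℝ) + 1) := by positivity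
    obtain ⟨δ, hδ, hδ'⟩ := Metric.continuous_iff.1 hcont t _ hε
    rcases (show (0 : ℝ≥0) ≤ t from zero_le).eq_or_lt with h0 | h0
    · refine ⟨0, by simp, by simp, ?_⟩
      have : ((0 : ℚ) : ℝ).toNNReal = t := by rw [← h0]; simp
      rw [this, ht0]
      exact hε
    · have h0' : (0 : ℝ) < t := h0
      have hlt : max 0 ((t : ℝ) - δ / 2) < t := max_lt h0' (by linarith)
      obtain ⟨q, hq1, hq2⟩ := exists_rat_btwn hlt
      have hq0 : (0 : ℝ) ≤ q := (le_max_left _ _).trans hq1.le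
      have hqt : (q : ℝ).toNNReal ≤ t := by
        rw [← NNReal.coe_le_coe, Real.coe_toNNReal _ hq0]
        exact hq2.le
      refine ⟨q, hq0, hqt.trans htT, ?_⟩
      have hdist : dist (q : ℝ).toNNReal t < δ := by
        have := (le_max_right _ _).trans_lt hq1
        rw [NNReal.dist_eq, Real.coe_toNNReal _ hq0, abs_sub_comm, abs_of_nonneg (by linarith)]
        linarith
      have := hδ' _ hdist
      rw [ht0, Real.dist_eq, sub_zero, abs_of_nonneg infDist_nonneg] at this
      exact this
  · intro h
    choose q hq0 hqT hq using h
    obtain ⟨a, ha, φ, hφ, hlim⟩ := (isCompact_Icc (a := (0 : ℝ≥0)) (b := T)).tendsto_subseq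
      (x := fun n ↦ ((q n : ℝ)).toNNReal) fun n ↦ ⟨zero_le, hqT n⟩
    refine ⟨a, ha.2, ?_⟩
    have h1 : Tendsto (fun n ↦ infDist (γ ((q (φ n) : ℝ)).toNNReal) A) atTop (𝓝 (infDist (γ a) A)) :=
      (hcont.tendsto a).comp hlim
    have h2 : Tendsto (fun n ↦ infDist (γ ((q (φ n) : ℝ)).toNNReal) A) atTop (𝓝 0) := by
      refine squeeze_zero (fun n ↦ infDist_nonneg) (fun n ↦ (hq (φ n)).le) ?_
      exact tendsto_one_div_add_atTop_nhds_zero_nat.comp hφ.tendsto_atTop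
    exact (hA.mem_iff_infDist_zero hne).2 (tendsto_nhds_unique h1 h2)

section Law

variable {E : Type*} [MeasurableSpace E] {ν : Measure E} {B : E → ℝ≥0 → ℂ} {T : E → ℝ≥0}

/-- **The bubble of a random rooted loop as a random element of `Ω_b`**: if almost every sample
`(B_e, T_e)` is a rooted loop, `T` is a.e.-measurable and so are the marginals at rational
times, there is a map `Kb : E → Ω_b`, measurable for the avoidance σ-field, which almost
everywhere is the bubble of the loop. (On a measurable full-measure set the loop is rooted with
duration and rational-time values given by measurable modifications; there `{Kb ∩ A = ∅}` is
the countable Boolean combination of `exists_le_mem_iff_forall_rat`, by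
`IsRootedLoop.disjoint_bubble_iff'`.) [cite: LawlerSchrammWerner2003Restriction, §7.1 (p. 28) with §3 (p. 10)] -/
theorem exists_measurable_bubble_version (hloop : ∀ᵐ e ∂ν, IsRootedLoop (B e) (T e))
    (hT : AEMeasurable T ν) (hmk : ∀ q : ℚ, AEMeasurable (fun e ↦ B e ((q : ℝ).toNNReal)) ν) :
    ∃ Kb : E → BubbleConfig, Measurable Kb ∧
      ∀ᵐ e ∂ν, ∃ h : IsRootedLoop (B e) (T e), Kb e = h.bubble := by
  classical
  set G : ℚ → E → ℂ := fun q ↦ (hmk q).mk _ with hG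
  have hGm : ∀ q, Measurable (G q) := fun q ↦ (hmk q).measurable_mk
  set T' : E → ℝ≥0 := hT.mk T with hT'
  have hT'm : Measurable T' := hT.measurable_mk
  have hgood : ∀ᵐ e ∂ν, IsRootedLoop (B e) (T e) ∧ T e = T' e ∧ ∀ q : ℚ, B e ((q : ℝ).toNNReal) = G q e :=
    hloop.and (hT.ae_eq_mk.and (ae_all_iff.2 fun q ↦ (hmk q).ae_eq_mk))
  obtain ⟨Sg, hSm, hSae, hS⟩ : ∃ Sg : Set E, MeasurableSet Sg ∧ (∀ᵐ e ∂ν, e ∈ Sg) ∧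
      ∀ e ∈ Sg, IsRootedLoop (B e) (T e) ∧ T e = T' e ∧ ∀ q : ℚ, B e ((q : ℝ).toNNReal) = G q e := by
    rw [ae_iff] at hgood
    obtain ⟨N, hNT, hNm, hN0⟩ := exists_measurable_superset_of_null hgood
    refine ⟨Nᶜ, hNm.compl, compl_mem_ae_iff.2 hN0, fun e he ↦ ?_⟩
    by_contra h
    exact he (hNT h)
  refine ⟨fun e ↦ if h : e ∈ Sg then (hS e h).1.bubble else BubbleConfig.verticalSegment, ?_, ?_⟩
  · refine BubbleConfig.measurable_of_measurableSet_preimage_avoid fun A hA ↦ ?_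
    rcases A.eq_empty_or_nonempty with rfl | hne
    · have : BubbleConfig.avoid (∅ : Set ℂ) = univ := by
        ext K
        simp
      rw [this, preimage_univ]
      exact MeasurableSet.univ
    have hAc : IsClosed A := hA.isBoundedHull.isClosed
    set EA : Set E := {e | ∀ n : ℕ, ∃ q : ℚ, (0 : ℝ) ≤ q ∧ (q : ℝ).toNNReal ≤ T' e ∧
      infDist (G q e) A < 1 / ((n : ℝ) + 1)} with hEA
    have hEAm : MeasurableSet EA := by
      have hrepr : EA = ⋂ n : ℕ, ⋃ q : ℚ, {e | (0 : ℝ) ≤ q ∧ (q : ℝ).toNNReal ≤ T' e ∧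
          infDist (G q e) A < 1 / ((n : ℝ) + 1)} := by
        ext e
        simp only [hEA, mem_setOf_eq, mem_iInter, mem_iUnion]
      rw [hrepr]
      refine MeasurableSet.iInter fun n ↦ MeasurableSet.iUnion fun q ↦ ?_
      by_cases hq : (0 : ℝ) ≤ q
      · simp only [hq, true_and]
        exact (measurableSet_le measurable_const hT'm).inter
          (measurableSet_lt ((continuous_infDist_pt A).measurable.comp (hGm q)) measurable_const)
      · simp only [hq, false_and, setOf_false]
        exact MeasurableSet.empty
    have heq : (fun e ↦ if h : e ∈ Sg then (hS e h).1.bubble else BubbleConfig.verticalSegment) ⁻¹'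
        BubbleConfig.avoid A =
          (Sg ∩ EAᶜ) ∪ (Sgᶜ ∩ {_e | Disjoint ((BubbleConfig.verticalSegment : BubbleConfig) : Set ℂ) A}) := by
      ext e
      simp only [mem_preimage, BubbleConfig.mem_avoid, mem_union, mem_inter_iff, mem_compl_iff]
      by_cases he : e ∈ Sg
      · obtain ⟨hl, hTe, hGe⟩ := hS e he
        rw [dif_pos he, hl.disjoint_bubble_iff' hA]
        have key : (∃ t ≤ T e, B e t ∈ A) ↔ e ∈ EA := by
          rw [exists_le_mem_iff_forall_rat hl.continuous hAc hne (T e)]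
          simp only [hEA, mem_setOf_eq, hTe, hGe]
        have hneg : (∀ t ≤ T e, B e t ∉ A) ↔ ¬ ∃ t ≤ T e, B e t ∈ A := by
          push Not
          exact Iff.rfl
        rw [hneg, key]
        simp only [he, true_and, not_true_eq_false, false_and, or_false]
      · rw [dif_neg he]
        simp only [he, false_and, not_false_eq_true, true_and, false_or, mem_setOf_eq]
    rw [heq]
    exact (hSm.inter hEAm.compl).union (hSm.compl.inter (MeasurableSet.const _))
  · filter_upwards [hSae] with e he
    exact ⟨(hS e he).1, by simp only [dif_pos he]⟩

/-- **"`μ` is a measure on `Ω_b` with (7.2)"** ([LSW] §7.1): if moreover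
`ν{∃ t ≤ T, B_t ∈ A} = starBubbleMass A (= −SΦ_A(0)/6)` for every `A ∈ 𝒬*`, the image of `ν`
under the `Ω_b`-valued version of the bubble is a Brownian bubble measure.
[cite: LawlerSchrammWerner2003Restriction, §7.1 eq. (7.2) (p. 28)] -/
theorem isBrownianBubbleMeasure_map_bubble (hloop : ∀ᵐ e ∂ν, IsRootedLoop (B e) (T e))
    (hT : AEMeasurable T ν) (hmk : ∀ q : ℚ, AEMeasurable (fun e ↦ B e ((q : ℝ).toNNReal)) ν)
    (hhit : ∀ ⦃A : Set ℂ⦄, IsStarHull A →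
      ν {e | ∃ t ≤ T e, B e t ∈ A} = ENNReal.ofReal (starBubbleMass A)) :
    ∃ Kb : E → BubbleConfig, Measurable Kb ∧
      (∀ᵐ e ∂ν, ∃ h : IsRootedLoop (B e) (T e), Kb e = h.bubble) ∧
        IsBrownianBubbleMeasure (ν.map Kb) := by
  obtain ⟨Kb, hKb, hae⟩ := exists_measurable_bubble_version hloop hT hmk
  refine ⟨Kb, hKb, hae, isBrownianBubbleMeasure_iff_measure_hit.2 fun A hA ↦ ?_⟩
  rw [Measure.map_apply hKb (BubbleConfig.measurableSet_hit hA)]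
  have heq : Kb ⁻¹' BubbleConfig.hit A =ᵐ[ν] {e | ∃ t ≤ T e, B e t ∈ A} := by
    filter_upwards [hae] with e ⟨h, he⟩
    simp only [eq_iff_iff]
    show Kb e ∈ BubbleConfig.hit A ↔ ∃ t ≤ T e, B e t ∈ A
    rw [BubbleConfig.mem_hit, he, h.disjoint_bubble_iff' hA]
    push Not
    exact Iff.rfl
  rw [measure_congr heq]
  exact hhit hA

/-- **The Brownian bubble measure exists as soon as some measure space carries a random rooted
loop in `ℍ` hitting each `A ∈ 𝒬*` with mass `−SΦ_A(0)/6`** — the deterministic half of [LSW]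
§7.1 ("`μ` … is a measure on the set of bounded `K ⊂ ℍ` with `cl K = K ∪ {0}`" satisfying (7.2),
`μ` the image of the loop measure under the filling map `Υ`); the probabilistic half — the
Brownian loop at `0` and its hitting masses (7.2) — is the input `hhit`.
[cite: LawlerSchrammWerner2003Restriction, §7.1 eqs. (7.1)–(7.2) (pp. 27–28)] -/
theorem exists_isBrownianBubbleMeasure_of_loopProcess (hloop : ∀ᵐ e ∂ν, IsRootedLoop (B e) (T e))
    (hT : AEMeasurable T ν) (hmk : ∀ q : ℚ, AEMeasurable (fun e ↦ B e ((q : ℝ).toNNReal)) ν)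
    (hhit : ∀ ⦃A : Set ℂ⦄, IsStarHull A →
      ν {e | ∃ t ≤ T e, B e t ∈ A} = ENNReal.ofReal (starBubbleMass A)) :
    exists_isBrownianBubbleMeasure := by
  obtain ⟨Kb, -, -, h⟩ := isBrownianBubbleMeasure_map_bubble hloop hT hmk hhit
  exact ⟨_, h⟩

end Law

end Literature.Probability.RandomPlanarGeometry

end
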